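import Summits.HodgeConjecture.HodgeConjecture.Theorems.SignSymmetricPowersSymmetricA3PlaneJet

/-!
# K1-B LINK-F witnesses (route `SignSymmetricPowers`, item stmt-HodgeConjecture-19716) — the symmetric `A₃`
# form at `e₀`, I: jets

Helper file for the registered stub `stub_signConfluenceLinkF` (K1-B line `andre-zariski` v12b, LINK-F; memo
`K1B-LINKF-PLAN-g23.md` §2): an explicit ι-even quinary form of every even degree `d = 2n + 4` carrying a
SYMMETRIC `A₃` point at `e₀ = [1:0:0:0:0]` with kernel direction `x₂` (the L/pair confluence datum
`IsSymmetricA3Datum f₁ g₀ g₂ 0 2 γ` of `HodgeTheory/PicardLefschetzSymmetricA3`) — the witness of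
`SignSymmetricPowersSymmetricA3PlaneJet` with the variables `(x₄, x₀, x₁, x₂, x₃) ↦ (x₀, x₂, x₁, x₃, x₄)`. This
part: the gradient in closed form and the jets at `e₀` (gradient `0`, Hessian of rank `3` killing `x₂`, no cubic
term `x₂² xᵢ`, quartic term `∂₂⁴ f₁(e₀) ≠ 0`), for arbitrary coefficients `c₀ c₁ c₃` (`c₀(2n+4) = 4` for the
quartic). Landed `--supports stmt-HodgeConjecture-19716` as a helper. Sorry-free; axioms standard.

`f₁ = x₀^{2n+2}(x₁² + x₃x₄) + x₀^{2n} x₂⁴ + c₀ x₂^{2n+4} + c₁ x₁^{2n+4} + x₃^{2n+4} + c₃ x₄^{2n+4}`.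
-/

set_option linter.dupNamespace false

noncomputable section

namespace Summit.HodgeConjecture.HodgeConjecture.Theorems.SignSymmetricPowersSymmetricA3LineJet

open MvPolynomial Literature.AlgebraicGeometry.Motives Literature.AlgebraicGeometry.HodgeTheory
open Summit.HodgeConjecture.HodgeConjecture.Theorems.SignSymmetricPowersNodalFormsTools
open Summit.HodgeConjecture.HodgeConjecture.Theorems.SignSymmetricPowersSymmetricA3PlaneJet

/-- The gradient of the `A₃`-witness (closed form, arbitrary `c₀ c₁ c₃`). -/
theorem pderiv_a3LineForm (n : ℕ) (c₀ c₁ c₃ : ℂ) :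
    let f : MvPolynomial (Fin 5) ℂ := X 0 ^ (2 * n + 2) * (X 1 ^ 2 + X 3 * X 4) + X 0 ^ (2 * n) * X 2 ^ 4 +
      C c₀ * X 2 ^ (2 * n + 4) + C c₁ * X 1 ^ (2 * n + 4) + X 3 ^ (2 * n + 4) + C c₃ * X 4 ^ (2 * n + 4)
    pderiv 0 f = C (2 * (n : ℂ) + 2) * X 0 ^ (2 * n + 1) * (X 1 ^ 2 + X 3 * X 4) +
      C (2 * (n : ℂ)) * X 0 ^ (2 * n - 1) * X 2 ^ 4 ∧
    pderiv 1 f = C 2 * X 0 ^ (2 * n + 2) * X 1 + C (c₁ * (2 * (n : ℂ) + 4)) * X 1 ^ (2 * n + 3) ∧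
    pderiv 2 f = C 4 * X 0 ^ (2 * n) * X 2 ^ 3 + C (c₀ * (2 * (n : ℂ) + 4)) * X 2 ^ (2 * n + 3) ∧
    pderiv 3 f = X 0 ^ (2 * n + 2) * X 4 + C (2 * (n : ℂ) + 4) * X 3 ^ (2 * n + 3) ∧
    pderiv 4 f = X 0 ^ (2 * n + 2) * X 3 + C (c₃ * (2 * (n : ℂ) + 4)) * X 4 ^ (2 * n + 3) := by
  intro f
  refine ⟨?_, ?_, ?_, ?_, ?_⟩ <;>
  · simp +decide only [f, map_add, Derivation.leibniz, Derivation.leibniz_pow, pderiv_X, pderiv_C,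
      Pi.single_apply, smul_eq_mul, mul_zero, add_zero, Nat.add_succ_sub_one, if_true, if_false,
      nsmul_eq_mul, Nat.cast_add, Nat.cast_mul, Nat.cast_ofNat, mul_one]
    simp only [map_add, map_mul, map_natCast, map_ofNat]
    ring

/-- The gradient of the `A₃`-witness as a vector of closed forms. -/
theorem pderiv_a3LineForm_eq (n : ℕ) (c₀ c₁ c₃ : ℂ) (j : Fin 5) :
    pderiv j (X 0 ^ (2 * n + 2) * (X 1 ^ 2 + X 3 * X 4) + X 0 ^ (2 * n) * X 2 ^ 4 +
      C c₀ * X 2 ^ (2 * n + 4) + C c₁ * X 1 ^ (2 * n + 4) + X 3 ^ (2 * n + 4) + C c₃ * X 4 ^ (2 * n + 4) :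
        MvPolynomial (Fin 5) ℂ) =
      (![C (2 * (n : ℂ) + 2) * X 0 ^ (2 * n + 1) * (X 1 ^ 2 + X 3 * X 4) +
            C (2 * (n : ℂ)) * X 0 ^ (2 * n - 1) * X 2 ^ 4,
          C 2 * X 0 ^ (2 * n + 2) * X 1 + C (c₁ * (2 * (n : ℂ) + 4)) * X 1 ^ (2 * n + 3),
          C 4 * X 0 ^ (2 * n) * X 2 ^ 3 + C (c₀ * (2 * (n : ℂ) + 4)) * X 2 ^ (2 * n + 3),
          X 0 ^ (2 * n + 2) * X 4 + C (2 * (n : ℂ) + 4) * X 3 ^ (2 * n + 3),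
          X 0 ^ (2 * n + 2) * X 3 + C (c₃ * (2 * (n : ℂ) + 4)) * X 4 ^ (2 * n + 3)] :
          Fin 5 → MvPolynomial (Fin 5) ℂ) j := by
  obtain ⟨h0, h1, h2, h3, h4⟩ := pderiv_a3LineForm n c₀ c₁ c₃
  fin_cases j
  exacts [h0, h1, h2, h3, h4]

/-- `∂₂∂₂ f₁` in closed form. -/
theorem pderiv_two_two_a3LineForm (n : ℕ) (c₀ c₁ c₃ : ℂ) :
    pderiv 2 (pderiv 2 (X 0 ^ (2 * n + 2) * (X 1 ^ 2 + X 3 * X 4) + X 0 ^ (2 * n) * X 2 ^ 4 +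
      C c₀ * X 2 ^ (2 * n + 4) + C c₁ * X 1 ^ (2 * n + 4) + X 3 ^ (2 * n + 4) + C c₃ * X 4 ^ (2 * n + 4) :
        MvPolynomial (Fin 5) ℂ)) =
      C 12 * X 0 ^ (2 * n) * X 2 ^ 2 + C (c₀ * (2 * (n : ℂ) + 4) * (2 * (n : ℂ) + 3)) * X 2 ^ (2 * n + 2) := by
  rw [pderiv_a3LineForm_eq n c₀ c₁ c₃ 2]
  simp +decide only [Matrix.cons_val_two, Matrix.tail_cons, Matrix.head_cons, map_add, Derivation.leibniz, Derivation.leibniz_pow, pderiv_X,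
    pderiv_C, Pi.single_apply, smul_eq_mul, mul_zero, add_zero, Nat.add_succ_sub_one, if_true, if_false,
    nsmul_eq_mul, Nat.cast_add, Nat.cast_mul, Nat.cast_ofNat, mul_one]
  simp only [map_add, map_mul, map_natCast, map_ofNat]
  ring

set_option maxHeartbeats 400000 in
/-- **The jets of the `A₃`-witness at `e₀`**: gradient `0`; Hessian of rank `3` with zero `x₂`-column; no cubic
terms `x₂² xᵢ`; quartic term `∂₂⁴ f₁(e₀) ≠ 0` (for `c₀ (2n+4) = 4`). -/
theorem jets_a3LineForm (n : ℕ) (c₀ c₁ c₃ : ℂ) (hc₀ : c₀ * (2 * n + 4) = 4) :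
    let f : MvPolynomial (Fin 5) ℂ := X 0 ^ (2 * n + 2) * (X 1 ^ 2 + X 3 * X 4) + X 0 ^ (2 * n) * X 2 ^ 4 +
      C c₀ * X 2 ^ (2 * n + 4) + C c₁ * X 1 ^ (2 * n + 4) + X 3 ^ (2 * n + 4) + C c₃ * X 4 ^ (2 * n + 4)
    (∀ i, eval (Pi.single 0 1) (pderiv i f) = 0) ∧
    (Matrix.of fun i i' : Fin 5 => eval (Pi.single 0 1) (pderiv i (pderiv i' f))).rank = 3 ∧
    (∀ i, eval (Pi.single 0 1) (pderiv i (pderiv 2 f)) = 0) ∧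
    (∀ i, eval (Pi.single 0 1) (pderiv i (pderiv 2 (pderiv 2 f))) = 0) ∧
    eval (Pi.single 0 1) (pderiv 2 (pderiv 2 (pderiv 2 (pderiv 2 f)))) ≠ 0 := by
  intro f
  have hcol := pderiv_a3LineForm_eq n c₀ c₁ c₃
  have h00 := pderiv_two_two_a3LineForm n c₀ c₁ c₃
  have hM : (Matrix.of fun i i' : Fin 5 => eval (Pi.single 0 1 : Fin 5 → ℂ) (pderiv i (pderiv i' f))) =
      !![0, 0, 0, 0, 0; 0, 2, 0, 0, 0; 0, 0, 0, 0, 0; 0, 0, 0, 0, 1; 0, 0, 0, 1, 0] := by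
    ext i i'
    rw [Matrix.of_apply, hcol i']
    fin_cases i <;> fin_cases i' <;> simp [Derivation.leibniz, Derivation.leibniz_pow, pderiv_X]
  refine ⟨fun i => ?_, ?_, fun i => ?_, fun i => ?_, ?_⟩
  · rw [hcol i]
    fin_cases i <;> simp
  · rw [hM]
    refine rank_eq_three (u := ![0, 1, 0, 1, 1]) (w := ![0, 2, 0, 1, 1]) (A := 1)
      (B := !![0, 0, 0, 0, 0; 0, 1, 0, 0, 0; 0, 0, 0, 0, 0; 0, 0, 0, 0, 1; 0, 0, 0, 1, 0]) 0 2 (by decide)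
      ?_ ?_ ?_ ?_
    · intro i; fin_cases i <;> simp
    · ext i j
      fin_cases i <;> fin_cases j <;> simp [Matrix.mul_apply, Matrix.diagonal]
    · ext i j
      fin_cases i <;> fin_cases j <;> simp [Matrix.mul_apply, Fin.sum_univ_five]
    · intro i; fin_cases i <;> simp
  · have h := congr_fun (congr_fun hM i) 2
    rw [Matrix.of_apply] at h
    rw [h]
    fin_cases i <;> simp
  · rw [h00]
    fin_cases i <;> simp [Derivation.leibniz, Derivation.leibniz_pow, pderiv_X]
  · rw [h00]
    rcases Nat.eq_zero_or_pos n with rfl | hn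
    · have hc : c₀ = 1 := by
        have : c₀ * 4 = 4 := by simpa using hc₀
        linear_combination this / 4
      subst hc
      simp [Derivation.leibniz, Derivation.leibniz_pow, pderiv_X]
      norm_num
    · simp [Derivation.leibniz, Derivation.leibniz_pow, pderiv_X, zero_pow (by omega : 2 * n ≠ 0)]

end Summit.HodgeConjecture.HodgeConjecture.Theorems.SignSymmetricPowersSymmetricA3LineJet

end
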